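import Literature.MathematicalPhysics.QuantumFieldTheory.Balaban1983to89.B8Eq138LandauZdRec
import Literature.MathematicalPhysics.QuantumFieldTheory.Balaban1983to89.B8Ineq159FlatShellModeCrossingDatum

/-!
# `Balaban1983to89.B8Eq138LandauFlatOrthogonalRec` — [Balaban1985RegularSpaces] (1.38) p. 82 ∕ [Balaban1984PropagatorsII] (2.12) p. 225 AT THE FLAT BACKGROUND, RECORD
# (CENTRED) BLOCKING: the multiplier form `B8Eq138LandauZdRec.IsLandau138Z … 1 φ` IMPLIES print's orthogonality form «R D*A = 0» — `Σ_x (Δ^η_1λ)(x)·(𝟙_{Ω₀}D^{η*}_1φ)(x) = 0`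
# for every `λ ∈ N(Q′)` (supported in `Ω₀`, `λ = 0` on `Λ₀`, vanishing sums over the CENTRED `Lʲ`-blocks of `Λ_j`, `j ≥ 1`); the record twin of n05-c's
# `B8Eq138LandauFlatOrthogonal` (LEAD PEN dag-n05-e; cell member dag-n05-d)

statement-level skeleton of published theorems with citation tags; proofs where landed; nothing here is a claim about the Yang–Mills mass gap

CITATION HEADER.  [6] = [Balaban1985RegularSpaces] (1.38) p. 82 («R(U₀)D^{η*}_{U₀}A = 0»), (1.29) p. 81; [Balaban1984PropagatorsII] (2.7) p. 224, (2.10)–(2.12) p. 225 («let R be an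
orthogonal projection in the space L²(T_η) onto the subspace ΔN(Q′) … Rd*A = 0»); [4] = [Balaban1985BackgroundPropagators] (3.19) p. 393, (3.23)–(3.25) p. 394; [I] =
[Balaban1987RG1] (0.3) p. 252 (centred blocks).  Cell `pub-ymgap`, seat dag-n05-d g23, «N05-REC» road item R2 (TOKEN RULE (T2): blocks `Bʲ(y) = Lʲy + [−c_j, c_j]ᵈ` = dag-n05-e's
`blockSitesZ (Lʲ) y` (`B8Eq119TwistedAxialRec.mem_blockSitesZ_pow_iff`), the `j`-fold floor `flmZ L j = (fl L)^[j]`; (T5) engine names).  REUSED: the summation by parts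
`B8Ineq159FlatShellModeCrossingDatum.finsum_mul_covLap_symm` (class 0).  `--kind proof --supports stmt-QuantumFields-20541` (K0⁷; count-neutral; no definition).

WHAT IS PROVED (sorry-free).  §1 the flat record transposes: `qprimeT1Z_flat_apply` (`(Q′ᵀν)(x) = L⁻ᵈν(fl x)`), `QprimeTZ_flat_apply` (`(Q′_jᵀν)(x) = L^{−dj}ν((fl)^[j] x)`),
★`QTZ_flat_apply` (`(Q′(1)ᵀμ)(x) = Σ_{j ≤ m} L^{−dj}(𝟙_{Λ_j}μ_j)(flmZ L j x)`, odd `L`).  §2 `sum_mul_comp_flmZ` (block-fibre sums over the centred `Lʲ`-blocks).  §3 ★★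
`pairing_covLap_eq_zero_of_isLandau138Z` — MULTIPLIER FORM ⇒ ORTHOGONALITY FORM of the flat Landau condition for the record blocking.
HONEST SCOPE.  Flat lattice bookkeeping, exactly the engine module's content with centred blocks (odd `L`); nothing of Bałaban's analysis asserted; `HThm4Rec` UNDISCHARGED; N05 ∕ N07
NOT discharged; counts unmoved; one finite 𝕋⁴ programme at fixed ε — nothing continuum ∕ ℝ⁴ ∕ OS ∕ mass gap ∕ Clay.  No `def`, no `instance`, no `notation`, no `sorry`.
-/

noncomputable section

namespace Literature.MathematicalPhysics.QuantumFieldTheory.Balaban1983to89.B8Eq138LandauFlatOrthogonalRec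

open B7Prop1Explicit
open B7Eq78Linearization (conjR conjR_apply)
open B8Ineq130Rec (fl)
open B8Eq119TwistedAxialRec (bgTZ_one flmZ flmZ_zero iterate_fl_eq_flmZ mem_blockSitesZ_pow_iff_flmZ)
open B7SectEFLinearisationRec (blockSitesZ)
open B8Eq138LandauZd (covLap covDivB)
open B8Eq138LandauZdRec (qprimeT1Z QprimeTZ QTZ IsLandau138Z)
open B8Ineq159FlatShellModeCrossingDatum (finsum_mul_covLap_symm)

export B7Prop1Explicit (Site)

variable {d : ℕ}

/-! ## §1 The flat record transposes `Q′(1)ᵀ` -/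

section Flat

variable {𝔸 : Type*} [NormedRing 𝔸] [NormedAlgebra ℂ 𝔸] [CompleteSpace 𝔸]

/-- One flat record transpose step: `(Q′ᵀν)(x) = L⁻ᵈν(fl x)`, `fl x` the coarse site whose CENTRED block contains `x` (`R(1) = id`).
[cite: Balaban1985BackgroundPropagators, (3.19) p.393; Balaban1987RG1, (0.3) p.252] -/
theorem qprimeT1Z_flat_apply (L : ℕ) (j : ℕ) (ν : Site d → 𝔸) (x : Site d) :
    qprimeT1Z L (1 : Site d → Fin d → 𝔸ˣ) j ν x = ((L : ℝ) ^ d)⁻¹ • ν (fl L x) := by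
  unfold qprimeT1Z
  rw [bgTZ_one]
  simp [conjR_apply]

/-- **The flat iterated record transpose**: `(Q′_jᵀν)(x) = L^{−dj}ν((fl)^[j] x)`. [cite: Balaban1985BackgroundPropagators, (3.19) p.393; Balaban1985Averaging, (3) p.17] -/
theorem QprimeTZ_flat_apply (L : ℕ) :
    ∀ (j : ℕ) (ν : Site d → 𝔸) (x : Site d),
      QprimeTZ L (1 : Site d → Fin d → 𝔸ˣ) j ν x = (((L : ℝ) ^ d)⁻¹) ^ j • ν ((fl L)^[j] x) := by
  intro j
  induction j with
  | zero =>
    intro ν x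
    show ν x = _
    rw [pow_zero, one_smul, Function.iterate_zero_apply]
  | succ j ih =>
    intro ν x
    show QprimeTZ L (1 : Site d → Fin d → 𝔸ˣ) j (qprimeT1Z L 1 j ν) x = _
    rw [ih, qprimeT1Z_flat_apply, smul_smul, ← pow_succ, Function.iterate_succ_apply']

/-- **The flat `Q′(1)ᵀ` on a multiplier, record blocking**: `(Q′(1)ᵀμ)(x) = Σ_{j ≤ m} L^{−dj}·(𝟙_{Λ_j}μ_j)(flmZ L j x)` (odd `L`: `(fl)^[j] = flmZ L j`).
[cite: Balaban1985BackgroundPropagators, (3.24) p.394; Balaban1985RegularSpaces, (1.29) p.81; Balaban1987RG1, (0.3) p.252] -/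
theorem QTZ_flat_apply {L : ℕ} (hL : Odd L) (m : ℕ) (Λs : ℕ → Set (Site d)) (μ : ℕ → Site d → 𝔸) (x : Site d) :
    QTZ L m Λs (1 : Site d → Fin d → 𝔸ˣ) μ x =
      ∑ j ∈ Finset.range (m + 1), (((L : ℝ) ^ d)⁻¹) ^ j • (Λs j).indicator (μ j) (flmZ L j x) := by
  unfold QTZ
  exact Finset.sum_congr rfl fun j _ => by rw [QprimeTZ_flat_apply, iterate_fl_eq_flmZ hL]

end Flat

/-! ## §2 Block-fibre sums over the centred `Lʲ`-blocks -/

/-- A block-fibre sum, centred blocks: `Σ_{x ∈ S} ν(x)·g(flmZ L j x) = Σ_{y} g(y)·Σ_{x ∈ Bʲ(y)} ν(x)` for `ν` supported in `S` (odd `L`; bookkeeping of (3.19)'s transpose «Q′ᵀ»).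
[cite: Balaban1985BackgroundPropagators, (3.19) p.393; Balaban1985Averaging, (2) p.17; Balaban1987RG1, (0.3) p.252] -/
theorem sum_mul_comp_flmZ {L : ℕ} (hL : Odd L) (j : ℕ) {ν : Site d → ℂ} {S : Finset (Site d)} (hS : Function.support ν ⊆ ↑S)
    (g : Site d → ℂ) :
    ∑ x ∈ S, ν x * g (flmZ L j x) = ∑ y ∈ S.image (flmZ L j), g y * ∑ x ∈ blockSitesZ (L ^ j) y, ν x := by
  classical
  symm
  refine Finset.sum_image' (fun x => ν x * g (flmZ L j x)) fun c _ => ?_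
  have hfib : ∑ x ∈ S with flmZ L j x = flmZ L j c, ν x * g (flmZ L j x) =
      ∑ x ∈ S with flmZ L j x = flmZ L j c, g (flmZ L j c) * ν x := by
    refine Finset.sum_congr rfl fun x hx => ?_
    rw [Finset.mem_filter] at hx
    rw [hx.2, mul_comm]
  rw [hfib, Finset.mul_sum]
  refine (Finset.sum_subset (fun x hx => ?_) (fun x hxB hxS => ?_)).symm
  · rw [Finset.mem_filter] at hx
    rw [mem_blockSitesZ_pow_iff_flmZ hL]; exact hx.2
  · rw [mem_blockSitesZ_pow_iff_flmZ hL] at hxB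
    have : ν x = 0 := by
      by_contra h
      exact hxS (Finset.mem_filter.2 ⟨hS (Function.mem_support.2 h), hxB⟩)
    rw [this, mul_zero]

/-! ## §3 Multiplier form ⇒ orthogonality form, record blocking -/

/-- ★★ **MULTIPLIER FORM ⇒ ORTHOGONALITY FORM OF THE FLAT LANDAU CONDITION (1.38), RECORD BLOCKING**: if `Δ^η_1(𝟙_{Ω₀}·D^{η*}_1φ) = Q′(1)ᵀμ` on the finite `Ω₀`
(`IsLandau138Z L m η Ω₀ Λs 1 φ`, centred blocks, odd `L`), then for every gauge function `λ` of `N(Q′)` — supported in `Ω₀`, `λ = 0` on `Λ₀ = Λs 0`, and with vanishing sums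
over the CENTRED `Lʲ`-blocks `Σ_{x ∈ Bʲ(y)} λ(x) = 0` for `y ∈ Λs j`, `1 ≤ j ≤ m` (the flat `Q′_jλ = 0`) — the pairing `Σ_x (Δ^η_1λ)(x)·(𝟙_{Ω₀}D^{η*}_1φ)(x)` vanishes: «R D* A = 0».
[cite: Balaban1985RegularSpaces, (1.38) p.82, (1.29) p.81; Balaban1984PropagatorsII, (2.7) p.224, (2.10)–(2.12) p.225; Balaban1985BackgroundPropagators, (3.19) p.393, (3.24)–(3.25) p.394; Balaban1987RG1, (0.3) p.252] -/
theorem pairing_covLap_eq_zero_of_isLandau138Z {L m : ℕ} (hL : Odd L) {η : ℝ} {Ω₀ : Set (Site d)} (hΩ : Ω₀.Finite)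
    {Λs : ℕ → Set (Site d)} {φ : Site d → Fin d → ℂ} (h : IsLandau138Z L m η Ω₀ Λs (1 : Site d → Fin d → ℂˣ) φ)
    {lam : Site d → ℂ} (hsupp : ∀ x, x ∉ Ω₀ → lam x = 0) (h0 : ∀ x ∈ Λs 0, lam x = 0)
    (hQ : ∀ j, 1 ≤ j → j ≤ m → ∀ y ∈ Λs j, ∑ x ∈ blockSitesZ (L ^ j) y, lam x = 0) :
    ∑ᶠ x, covLap η (1 : Site d → Fin d → ℂˣ) lam x * Ω₀.indicator (covDivB η (1 : Site d → Fin d → ℂˣ) φ) x = 0 := by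
  classical
  obtain ⟨μ, hμ⟩ := h
  have hsuppL : (Function.support lam).Finite := hΩ.subset fun x hx => by
    by_contra h'; exact hx (hsupp x h')
  have hsuppG : (Function.support (Ω₀.indicator (covDivB η (1 : Site d → Fin d → ℂˣ) φ))).Finite :=
    hΩ.subset (Set.support_indicator_subset)
  -- move `Δ^η_1` to the other side
  rw [← finsum_mul_covLap_symm η hsuppL hsuppG]
  set S := hΩ.toFinset with hSdef
  have hS : Function.support lam ⊆ ↑S := fun x hx => by
    rw [hSdef, Set.Finite.coe_toFinset]; by_contra h'; exact hx (hsupp x h')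
  rw [finsum_eq_sum_of_support_subset _ (fun x hx => hS (Function.support_mul_subset_left _ _ hx))]
  have hrow : ∀ x ∈ S, lam x * covLap η (1 : Site d → Fin d → ℂˣ) (Ω₀.indicator (covDivB η (1 : Site d → Fin d → ℂˣ) φ)) x =
      ∑ j ∈ Finset.range (m + 1), (((L : ℝ) ^ d)⁻¹) ^ j • (lam x * (Λs j).indicator (μ j) (flmZ L j x)) := by
    intro x hx
    have hxΩ : x ∈ Ω₀ := by rw [hSdef, Set.Finite.mem_toFinset] at hx; exact hx
    rw [hμ x hxΩ, QTZ_flat_apply hL, Finset.mul_sum]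
    refine Finset.sum_congr rfl fun j _ => ?_
    rw [mul_smul_comm]
  rw [Finset.sum_congr rfl hrow, Finset.sum_comm]
  refine Finset.sum_eq_zero fun j hj => ?_
  rw [← Finset.smul_sum, smul_eq_zero]
  right
  rcases Nat.eq_zero_or_pos j with rfl | hjpos
  · -- level 0: `λ = 0` on `Λ₀`
    refine Finset.sum_eq_zero fun x _ => ?_
    rw [flmZ_zero]
    by_cases hx0 : x ∈ Λs 0
    · rw [h0 x hx0, zero_mul]
    · rw [Set.indicator_of_notMem hx0, mul_zero]
  · -- level `j ≥ 1`: group by centred blocks; the block sums of `λ` vanish on `Λ_j`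
    rw [sum_mul_comp_flmZ hL j hS]
    refine Finset.sum_eq_zero fun y _ => ?_
    by_cases hy : y ∈ Λs j
    · rw [hQ j hjpos (by simpa [Finset.mem_range, Nat.lt_succ_iff] using hj) y hy, mul_zero]
    · rw [Set.indicator_of_notMem hy, zero_mul]

end Literature.MathematicalPhysics.QuantumFieldTheory.Balaban1983to89.B8Eq138LandauFlatOrthogonalRec

/-! ## Axiom audit (gate whitelist: `propext`, `Classical.choice`, `Quot.sound`) -/
#print axioms Literature.MathematicalPhysics.QuantumFieldTheory.Balaban1983to89.B8Eq138LandauFlatOrthogonalRec.pairing_covLap_eq_zero_of_isLandau138Z
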